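import Summits.Langlands.Langlands.Statement
import Literature.NumberTheory.Automorphic.KimExteriorSquareGL4
import Literature.NumberTheory.Automorphic.GLnAdelicStructureProofs
import HarnessLib

/-!
# Line `ExteriorSquareGL5GaloisToAutomorphic` — F3 SPECIAL-CASE FILE (forward generator G4 ladder-down, generation 14)
# top crux `IrreducibilityBySelfDuality.ReciprocityUpToIrreducibility` (stmt-Langlands-14328)

Dial θ17 = the SOURCE RANK `m` of the exterior-square lift `∧² : GL_m → GL_{m(m-1)/2}` in clause (B) of E, over
EVERY number field `F`.  Contents (no `sorry`): §1 the a.e. `∧²`-lift predicate `IsWedgeTwoLiftAE` and the text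
family `WeakExteriorSquareFunctoriality m`; §2 the graded family `ExteriorSquareGaloisToAutomorphic m` (target rank
`m * (m - 1) / 2`) and THE RUNG `ExteriorSquareGL5GaloisToAutomorphic := ExteriorSquareGaloisToAutomorphic 5`
(rank 10); §3 the bridge `of_weakExteriorSquareFunctoriality`; §4 the floor `floor_four (h : Kim2003_exteriorSquare_GL4)`
— THE WITNESS: Kim 2003 Theorem A (`∧² : GL₄ → GL₆`), the in-tree named fact
`Literature.NumberTheory.Automorphic.Kim2003_exteriorSquare_GL4` [cite: Kim2002, Theorem A (p. 139), Thm. 5.3.1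
(p. 165)], target rank `4 * 3 / 2 = 6` by `rfl` — and the F3 instance
`example (h) : ExteriorSquareGaloisToAutomorphic 4 := by simpa using floor_four h`.
-/

noncomputable section

set_option linter.dupNamespace false

open scoped MatrixGroups Matrix NumberField Classical Polynomial
open Filter IsDedekindDomain Field Polynomial
open Literature.NumberTheory.Automorphic Literature.NumberTheory.GaloisRepresentations
open Literature.NumberTheory.PAdicHodge
open Summit.Langlands

namespace Summit.Langlands.Langlands.Cruxes.ReciprocityUpToIrreducibility.ExteriorSquareGL5GaloisToAutomorphic

/-! ## 1. Weak exterior-square lifts in the Borel–Jacquet datum model -/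

/-- **`P` is an almost-everywhere exterior-square lift of `π`** (`t_{P,v} = ∧² t_{π,v}` for almost all `v`):
for all but finitely many finite places `v`, whenever `π` on `GL_m(𝔸_F)` has Satake parameter `α` at `v`,
`P` on `GL_{m(m-1)/2}(𝔸_F)` has Satake parameter `wedgeTwoParams α = {αᵢαⱼ : i < j}` at `v`.  Same design as the
first clause of `Kim2003_exteriorSquare_GL4` and as `IsSymmSqLiftAE` (Gelbart–Jacquet file). [cite: Kim2002, Theorem A] -/
def IsWedgeTwoLiftAE (m : ℕ) {F : Type} [Field F] [NumberField F]
    {hm : isCompact_glFiniteIntegralLevel m F} {hN : isCompact_glFiniteIntegralLevel (m * (m - 1) / 2) F}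
    (π : AutomorphicRepData (AutomorphyDatum.gl m F hm))
    (P : AutomorphicRepData (AutomorphyDatum.gl (m * (m - 1) / 2) F hN)) : Prop :=
  ∀ᶠ v : HeightOneSpectrum (𝓞 F) in cofinite, ∀ α : Multiset ℂ,
    π.HasSatakeParamAt v α → P.HasSatakeParamAt v (wedgeTwoParams α)

/-- **Weak `∧²` functoriality `GL_m → GL_{m(m-1)/2}` over every number field** (the text family of which
Kim 2003 Thm A is `m = 4`; `m = 2` (`∧² = det`) and `m = 3` (`∧²π ≅ π^∨ ⊗ ω_π`) are elementary in print; `m ≥ 5` is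
OPEN): every cuspidal `π` on `GL_m(𝔸_F)` has an a.e. `∧²`-lift which is an automorphic representation of
`GL_{m(m-1)/2}(𝔸_F)` (Borel–Jacquet datum, not asserted cuspidal). -/
def WeakExteriorSquareFunctoriality (m : ℕ) : Prop :=
  ∀ (F : Type) [Field F] [NumberField F] (hm : isCompact_glFiniteIntegralLevel m F)
    (hN : isCompact_glFiniteIntegralLevel (m * (m - 1) / 2) F) (π : CuspidalAutomorphicRepData m F hm),
    ∃ P : AutomorphicRepData (AutomorphyDatum.gl (m * (m - 1) / 2) F hN), IsWedgeTwoLiftAE m π.1 P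

/-! ## 2. The graded family (dial = source rank `m` of `∧²`, target rank `m(m-1)/2`) and the rung `m = 5` -/

/-- **The rung family** `ExteriorSquareGaloisToAutomorphic m`: clause (B) of the summit (Galois ⇒ automorphic) over
EVERY number field `F`, at EVERY `ℓ` and `ι : ℚ̄_ℓ ≃ ℂ`, in the a.e.-Satake form, for irreducible
`ρ : Γ_F → GL_{m(m-1)/2}(ℚ̄_ℓ)` de Rham above `ℓ` (pinned Fontaine datum `fontainePstAdicCompletion`) whose Frobenius
characteristic polynomials are, at all but finitely many places, the `ι`-Satake polynomials of `∧² α_v` for the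
Satake parameters `α_v` of a CUSPIDAL `π` on `GL_m(𝔸_F)` — the unramified shadow of "`ρ ≅ ∧² ρ_π`".
Conclusion: an AUTOMORPHIC `P` on `GL_{m(m-1)/2}(𝔸_F)` (Borel–Jacquet datum, not asserted cuspidal) with
`SatakeFrobCompatibleAt ι P ρ v` for almost all `v`.  Implied by the summit for every `m ≥ 2`
(`exteriorSquareGaloisToAutomorphic_of_langlands`); implied by weak `∧²` functoriality at `m`
(`of_weakExteriorSquareFunctoriality`), hence PROVED at `m = 4` modulo the in-tree named fact (Kim 2003 Thm A) and
elementary at `m = 2, 3`; OPEN at `m = 5` (`GL₅ → GL₁₀`). -/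
def ExteriorSquareGaloisToAutomorphic (m : ℕ) : Prop :=
  ∀ (F : Type) [Field F] [NumberField F]
    (hm : Literature.NumberTheory.Automorphic.isCompact_glFiniteIntegralLevel m F)
    (π : Literature.NumberTheory.Automorphic.CuspidalAutomorphicRepData m F hm)
    (ℓ : ℕ) [Fact ℓ.Prime] (ι : PadicAlgCl ℓ ≃+* ℂ)
    (ρ : Literature.NumberTheory.GaloisRepresentations.FramedGaloisRep F (PadicAlgCl ℓ) (m * (m - 1) / 2)),
    ρ.toGaloisRep.IsIrreducible →
    (∀ (v : IsDedekindDomain.HeightOneSpectrum (NumberField.RingOfIntegers F))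
      (hv : ((ℓ : ℕ) : NumberField.RingOfIntegers F) ∈ v.asIdeal),
      (Literature.NumberTheory.PAdicHodge.fontainePstAdicCompletion v ℓ hv).IsDeRhamFramed (ρ.toLocal v)) →
    (∀ᶠ v : IsDedekindDomain.HeightOneSpectrum (NumberField.RingOfIntegers F) in Filter.cofinite,
      ∃ α : Multiset ℂ, π.1.HasSatakeParamAt v α ∧ ρ.IsUnramifiedAt v ∧
        ρ.HasFrobCharpolyAt v
          (Literature.NumberTheory.Automorphic.arithFrobPolyOfSatake ι v.residueCard 1
            (Literature.NumberTheory.Automorphic.wedgeTwoParams α))) →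
    ∀ hcpt : Literature.NumberTheory.Automorphic.isCompact_glFiniteIntegralLevel (m * (m - 1) / 2) F,
      ∃ P : Literature.NumberTheory.Automorphic.AutomorphicRepData
          (Literature.NumberTheory.Automorphic.AutomorphyDatum.gl (m * (m - 1) / 2) F hcpt),
        ∀ᶠ v : IsDedekindDomain.HeightOneSpectrum (NumberField.RingOfIntegers F) in Filter.cofinite,
          Summit.Langlands.SatakeFrobCompatibleAt ι P ρ v

/-- **THE RUNG** (the filed statement): the family at `m = 5` — clause (B) for irreducible de Rham
`GL₁₀`-representations of exterior-square-of-`GL₅` type over every number field. -/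
def ExteriorSquareGL5GaloisToAutomorphic : Prop := ExteriorSquareGaloisToAutomorphic 5

/-! ## 3. Weak functoriality at `m` gives the rung family at `m` -/

/-- **`WeakExteriorSquareFunctoriality m → ExteriorSquareGaloisToAutomorphic m`**: the automorphic a.e. `∧²`-lift
`P` of `π` has, at almost every `v`, the Satake parameter `∧² α_v`, which is what the sector clause says
`ρ(Frob_v)` has as inverse-root data. [folklore] -/
theorem of_weakExteriorSquareFunctoriality {m : ℕ} (h : WeakExteriorSquareFunctoriality m) :
    ExteriorSquareGaloisToAutomorphic m := by
  intro F _ _ hm π ℓ _ ι ρ _hirr _hdR hsec hcpt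
  obtain ⟨P, hP⟩ := h F hm hcpt π
  refine ⟨P, ?_⟩
  have hP' : ∀ᶠ v : HeightOneSpectrum (𝓞 F) in cofinite, ∀ α : Multiset ℂ,
      π.1.HasSatakeParamAt v α → P.HasSatakeParamAt v (wedgeTwoParams α) := hP
  filter_upwards [hsec, hP'] with v hv hPv
  obtain ⟨α, hπ, hur, hcp⟩ := hv
  exact ⟨wedgeTwoParams α, hPv α hπ, hur, hcp⟩

/-! ## 4. The floor `m = 4` (Kim 2003 Theorem A, IN TREE as a named fact) -/

/-- **Kim 2003 Thm A gives weak `∧²` functoriality at `m = 4`** (target rank `4 * 3 / 2 = 6` by `rfl`; the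
standing compactness facts are propositions, so Kim's uniform family `hF` is supplied by
`isCompact_glFiniteIntegralLevel_holds`). [cite: Kim2002, Theorem A (p. 139) and Thm. 5.3.1 (p. 165)] -/
theorem weakExteriorSquareFunctoriality_four (h : Kim2003_exteriorSquare_GL4) :
    WeakExteriorSquareFunctoriality 4 := by
  intro F _ _ h4 h6 π
  obtain ⟨P, hP⟩ := Kim2003_exteriorSquare_GL4.exists_weakLift h F
    (fun k => isCompact_glFiniteIntegralLevel_holds k F) π
  exact ⟨P, hP⟩

/-- **THE FLOOR of the ladder (`m = 4`, PROVED modulo the in-tree named fact)**: clause (B) for irreducible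
de Rham `ρ : Γ_F → GL₆(ℚ̄_ℓ)` of exterior-square-of-`GL₄` type, over every number field — Kim 2003 Theorem A.
[cite: Kim2002, Theorem A] -/
theorem floor_four (h : Kim2003_exteriorSquare_GL4) : ExteriorSquareGaloisToAutomorphic 4 :=
  of_weakExteriorSquareFunctoriality (weakExteriorSquareFunctoriality_four h)

/-- **F3 special-case instance**: the family at the floor parameter `m = 4` IS the floor (modulo the floor's
in-tree named fact, exactly as the tree holds it). -/
example (h : Kim2003_exteriorSquare_GL4) : ExteriorSquareGaloisToAutomorphic 4 := by
  simpa using floor_four h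

end Summit.Langlands.Langlands.Cruxes.ReciprocityUpToIrreducibility.ExteriorSquareGL5GaloisToAutomorphic

end
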